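import Literature.MathematicalPhysics.QuantumFieldTheory.Balaban1983to89.B9Thm313WholeHolderZ
import Literature.MathematicalPhysics.QuantumFieldTheory.Balaban1983to89.B9Thm313WholeL2GPZ

/-!
# `Balaban1983to89.B9Thm313WholeLettersCut` — [B9] Theorem 3.13 (p. 426): the letter schemas of the (3.152)–(3.153) reduction RE-CUT TO
# PRINT'S SPECIES (layer L0 of the «N06 LETTERS-SPECIES RE-CUT»): `Letters313Zc`, `Letters313HZc`, `Letters313L2Pc`

T. Bałaban, *Propagators for lattice gauge theories in a background field*, Commun. Math. Phys. **99** (1985) 389–434 [`Balaban1985BackgroundPropagators`,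
"B9"]; [4] = T. Bałaban, *Propagators and renormalization transformations for lattice gauge theories. II*, Commun. Math. Phys. **96** (1984) 223–250
[`Balaban1984PropagatorsII`].  statement-level skeleton of published theorems with citation tags; proofs where landed; nothing here is a claim about
the Yang–Mills mass gap.

THE PRINT.  p. 426, (3.152): *"RD\*G₁ = RG′D\*, and G₁DR = DG′R"*; (3.153): *"𝔊 = G₁ − G₁DRD\*G₁ − G₁Q\*(QG₁Q\*)⁻¹QG₁ = G₁𝔓\* = 𝔓G₁"*, and
*"The formulas (3.147), (3.153) permit us to reduce properties of the operators 𝔓, 𝔊 to the corresponding properties of the operators G′, (Q′G′²Q′\*)⁻¹, G₁,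
(QG₁Q\*)⁻¹"*; p. 398: the sup lines (3.42) carry the prefactors (Lʲη)², Lʲη, Lʲη, 1; the MIXED sup entry |∇_UG∇\*_Uλ| is (3.44), whose right side carries
the HÖLDER norm of λ (B′₀(ε) → ∞ as ε → 0); (3.43), (3.45) are the Hölder-output lines; (3.46) lists SIX block-L² lines of total derivative order ≦ 2;
(3.49) p. 399 bounds P = the projection in R = ϱ(I − P).

WHY THIS FILE (cell `pub/ym-inputs`, memos `LETTERS-313-LOCATE-p04.md` §2∕§6∕§7, `N06-RECUT-TWIN-LOCATE-p03g2.md`, `RECUT-BILL-L0-DESIGN-p04.md`;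
★★OWNER `ym3-torus-plan` WANTED №g26-7; CONFIRMED by the letter owner `dag-n06-l`).  Three displayed fields of the schemas of record are typed
BEYOND print's species and have no MEMBER-UNIFORM supplier at genuine operators: `B9Thm313WholeZ.Letters313Z.rgd1` (R·D\*·G₁·∇\*_U between PURE
sharp-block sup classes = the (3.44) species without its Hölder term; Calderón–Zygmund endpoint, best constant ≳ 0.64·j·ln L at a member of level j),
`B9Thm313WholeL2GPZ.Letters313L2PZ.ddGDv ∕ .rgdDds` (net derivative order +1 in PLAIN block-L² against a factor (Lʲη)⁻¹; constant ≳ Lʲ).  Print's own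
reduction needs none of them: re-associating the middle term of (3.153) with (3.152) cuts it at G₁∇\*_U ∈ sup ⊕ Hölder and at the ORDER-ZERO words
D·G′·R·D\* (sup side), D·R·D\*·G₁, G₁·D·R·D\* (L² side).  The re-cut CONSUMERS are landed (`B9Thm313WholeEntry2HolderCut`, `…L2DerivCut`,
`…Probe43RHolderCut`, seat ym-inputs-p04).  THIS FILE is the SCHEMA layer they dictate (the design note's §2 shapes VERBATIM, so those consumers are
fed at `BX := B₃`, `BW := B₃`, `BWE := Bx β`):
* §1 `const313c` — the constant of the re-cut (3.42)₃ entry (`const313` with the middle summand κ·B₃·B₃·c), `_nonneg`, `_mono`;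
* §2 ★ `Letters313Zc 𝔬 Gp R₀ H₀ hG wZ hwZ B₃ δ₃ bXH U` — `Letters313Z`'s fields `gD2 gQs2 gQs1 rgd2 c1_2 c1_1 q2 q1` VERBATIM, `gD1 ∕ rgd1` REMOVED,
  NEW `gXH` (G₁∇\*_U : Y⁰ → `bXH`, (3.42)₃ ⊕ (3.43)₂ for G₁) and `wGp` (D·G′·R·D\* : `bXH` → 𝔠⁽¹⁾, (3.44) for G′ + (3.49)); `Letters313Zc.of_Z`;
* §3 ★ `Letters313HZc 𝔬 𝔭 Gp R₀ H₀ hG wZ hwZ bW BhD Bx δ₃ bXH U` — `Letters313HZ`'s `pYDH pXQs` VERBATIM, `pXDv` REMOVED (unread after the cut),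
  NEW `pWE β` (Φ^X_β∘(D·G′·R·D\*) : `bXH` → 𝔠_P^{(β−1)}, (3.45) for G′ + (3.49)); `Letters313HZc.of_HZ`;
* §4 ★ `Letters313L2Pc 𝔬 Dd Dds R₀ H₀ B₄ δ vZ hvZ U` — `Letters313L2PZ`'s `gDv dGDv gQs ddGQs dGQs rgdI rgdDs c1 q` VERBATIM, `ddGDv ∕ rgdDds`
  REMOVED, NEW `vDRDG` (D·R·D\*·G₁) and `vGDRD` (G₁·D·R·D\*) in block-L² with the len-ratio factors ((3.46)₃ for G′ via (3.152) + (3.49));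
  `Letters313L2Pc.toLap` (→ `Letters313L2Z … 0 …`), `letters313L2Pc_mono`, `Letters313L2Pc.of_L2PZ`.
The free data: `Gp : Cfg → End (W → ℝ)` (the G′ letter of `B9Thm313WholeRgdFrom3152.Ids3152`, displayed separately as the identity (3.152)) and ONE
free class `bXH : BlockNorm … (X → ℝ)` per member (the device of `Letters313DZ`'s `bH`).  The Zc-twins of the whole-record readers and of the
row-21 chain (`…CutCores`, `…CutInputCores`, `…BlocksPairMZCut`, `…LeafRelZCut`, `…BlocksPairMBZCut`, `…LeafCompletePairMBZCut`) follow in sequels.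

HONEST SCOPE.  HYPOTHESIS SCHEMAS and bookkeeping between them — nothing of [B9]'s estimates is asserted; the five new letters are DISPLAYED
hypotheses of printed species (each a short composite of printed lines + (3.49) + (3.152), dischargeable at the pins in the `…AtPins` genre), not
discharged here; count-neutral; N06 NOT discharged; one finite lattice at a time — nothing continuum ∕ ℝ⁴ ∕ OS ∕ mass gap ∕ Clay.  Cell `pub-ymgap`
(HUMAN RULING D-0062), Track A node N06 [B9], bundle F7 rows 20–21, seat `pub-ymgap-dag-n06-l` (g19), 2026-08-28.  NEW file; `Letters313Z ∕ HZ ∕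
L2PZ` stay as records; nothing landed is modified.
-/

namespace Literature.MathematicalPhysics.QuantumFieldTheory.Balaban1983to89.B9Thm313WholeLettersCut

open Literature.MathematicalPhysics.QuantumFieldTheory.Balaban1983to89
open Finset B6RandomWalk B6RandomWalkHom B9Thm34Ext B9Thm37GlueCor36 B11SectG B9SectDSup B9SectDL2Decay
open B9Thm37AllNorms B9Thm37AllNormsInstances B9Thm312Whole B9Thm312WholeLeaf B9Thm312WholeLeft B9Thm313Whole B9Thm313WholeLeft
open B9RWSums343Holder B9Ineq347 B9Thm312WholeClasses B9Thm312WholeHolder B9Thm312WholeHHolder B9Thm313WholeHolder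
open B9Thm313WholeZ B9Thm313WholeLeftZ B9Thm313WholeHolderZ B9Thm313WholeL2G B9Thm313WholeL2GP B9Thm313WholeL2GZ B9Thm313WholeL2GPZ

noncomputable section

/-! ## §1 The constant of the re-cut (3.42)₃ entry -/

section Const

/-- **THE CONSTANT OF THE RE-CUT (3.42)₃ ENTRY OF 𝔊**: A₁ + κ·B₃·B₃·c + A₃(B₃(B₃A₁c)c)c — `B9Thm313Whole.const313` with its middle summand
A₃·B₃·c (the old cut (G₁D)∘(RD\*G₁∇\*)) replaced by κ·B₃·B₃·c (the cut (D·G′·R·D\*)∘(G₁∇\*) through a class of cutting cost κ); it is the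
constant of `B9Thm313WholeEntry2HolderCut.GG_entry2_holderCut_of_letters` at B_X = B_W = B₃.
[cite: Balaban1985BackgroundPropagators, Thm 3.13 p.426 + (3.152)–(3.153) p.426 (bookkeeping)] -/
def const313c (A₁ A₃ B₃ κ c : ℝ) : ℝ :=
  A₁ + κ * B₃ * B₃ * c + A₃ * (B₃ * (B₃ * A₁ * c) * c) * c

/-- `const313c` is non-negative for non-negative data. [cite: Balaban1985BackgroundPropagators, Thm 3.13 p.426 (bookkeeping)] -/
theorem const313c_nonneg {A₁ A₃ B₃ κ c : ℝ} (h₁ : 0 ≤ A₁) (h₃ : 0 ≤ A₃) (hB : 0 ≤ B₃) (hκ : 0 ≤ κ) (hc : 0 ≤ c) :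
    0 ≤ const313c A₁ A₃ B₃ κ c := by
  unfold const313c
  positivity

/-- `const313c` is monotone in (A₁, A₃, κ) for non-negative data. [cite: Balaban1985BackgroundPropagators, Thm 3.13 p.426 (bookkeeping)] -/
theorem const313c_mono {A₁ A₁' A₃ A₃' B₃ κ κ' c : ℝ} (h₁ : 0 ≤ A₁) (h₁' : A₁ ≤ A₁') (h₃ : 0 ≤ A₃) (h₃' : A₃ ≤ A₃') (hB : 0 ≤ B₃)
    (hκ' : κ ≤ κ') (hc : 0 ≤ c) : const313c A₁ A₃ B₃ κ c ≤ const313c A₁' A₃' B₃ κ' c := by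
  unfold const313c
  have hA₃' : 0 ≤ A₃' := h₃.trans h₃'
  have h4 : κ * B₃ * B₃ * c ≤ κ' * B₃ * B₃ * c := by gcongr
  have h5 : A₃ * (B₃ * (B₃ * A₁ * c) * c) * c ≤ A₃' * (B₃ * (B₃ * A₁' * c) * c) * c := by gcongr
  linarith

end Const

/-! ## §2 The sup letters re-cut (printed species; nothing asserted) -/

section Letters

variable {g : B9.Geometry} {B : B9.Backgrounds} {X Y Z W PX PY P : Type}
variable [Fintype X] [Fintype Y] [Fintype Z] [Fintype W] [Fintype PX] [Fintype PY] [Fintype g.Site]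

/-- ★ **THE LETTERS OF THEOREM 3.13's REDUCTION AT U, RE-CUT TO PRINT'S SPECIES** (`B9Thm313WholeZ.Letters313Z` minus `gD1 ∕ rgd1`, plus the two
letters of the (3.152)-cut of the middle term of (3.153)): `gD2 gQs2 gQs1 rgd2 c1_2 c1_1 q2 q1` VERBATIM (coarse factors through the weighted classes
`Z_{wZ}`, `Z_{len·wZ}`); `gXH` — G₁∇\*_U : Y⁰ → `bXH` (B₃·e^{−δ₃d}; print's (3.42)₃ ⊕ (3.43)₂ species for G₁, the class `bXH` FREE); `wGp` — the
order-zero site word D·G′·R·D\* : `bXH` → 𝔠⁽¹⁾ (B₃·e^{−δ₃d}; print's (3.44) species for G′ with (3.49) for R = ϱ(I − P)).  `Gp` = the G′ letter of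
`Ids3152`.  NOTHING ASSERTED: these are the instance's (Theorem 3.1 ∕ 3.10 ∕ 3.12, (3.49), (3.126), (3.132), (3.152)).
[cite: Balaban1985BackgroundPropagators, Thm 3.13 p.426 + (3.152)–(3.153) p.426 + (3.132) p.422 + (3.126) p.420 + (3.42)–(3.44) pp.397–398 + (3.49) p.399] -/
structure Letters313Zc (𝔬 : Ops g B X Y Z W) (Gp : B.Cfg → Module.End ℝ (W → ℝ)) (R₀ : ℝ) (H₀ : Prop) (hG : GeoOK g)
    (wZ : g.Site → ℝ) (hwZ : ∀ y, 0 < wZ y) (B₃ δ₃ : ℝ) (bXH : BlockNorm (toB6 g R₀ H₀) (X → ℝ)) (U : B.Cfg) : Prop where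
  gD2 : HasMaj (cNorm R₀ H₀ 𝔬.blkW hG.lenle 1) (cNorm R₀ H₀ 𝔬.blk hG.lenle 2) (𝔬.G0 U ∘ₗ 𝔬.Dv U)
    (fun a b => B₃ * Real.exp (-(δ₃ * g.dist a b)))
  gQs2 : HasMaj (weightNorm (BlockNorm.ofBlocks (toB6 g R₀ H₀) 𝔬.blkZ) wZ fun y => (hwZ y).le) (cNorm R₀ H₀ 𝔬.blk hG.lenle 2)
    (𝔬.G0 U ∘ₗ 𝔬.Qstar U)
    (fun a b => B₃ * Real.exp (-(δ₃ * g.dist a b)))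
  gQs1 : HasMaj (weightNorm (BlockNorm.ofBlocks (toB6 g R₀ H₀) 𝔬.blkZ) (fun y => g.len y * wZ y) fun y => (wZlen_pos hG hwZ y).le)
    (cNorm R₀ H₀ 𝔬.blk hG.lenle 1) (𝔬.G0 U ∘ₗ 𝔬.Qstar U) (fun a b => B₃ * Real.exp (-(δ₃ * g.dist a b)))
  rgd2 : HasMaj (cNorm R₀ H₀ 𝔬.blk hG.lenle 0) (cNorm R₀ H₀ 𝔬.blkW hG.lenle 1) (𝔬.R U ∘ₗ 𝔬.Dvstar U ∘ₗ 𝔬.G1 U ∘ₗ LinearMap.id)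
    (fun a b => B₃ * Real.exp (-(δ₃ * g.dist a b)))
  c1_2 : HasMaj (cNorm R₀ H₀ 𝔬.blkZ hG.lenle 2) (weightNorm (BlockNorm.ofBlocks (toB6 g R₀ H₀) 𝔬.blkZ) wZ fun y => (hwZ y).le) (𝔬.C1 U)
    (fun a b => B₃ * Real.exp (-(δ₃ * g.dist a b)))
  c1_1 : HasMaj (cNorm R₀ H₀ 𝔬.blkZ hG.lenle 1)
    (weightNorm (BlockNorm.ofBlocks (toB6 g R₀ H₀) 𝔬.blkZ) (fun y => g.len y * wZ y) fun y => (wZlen_pos hG hwZ y).le) (𝔬.C1 U)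
    (fun a b => B₃ * Real.exp (-(δ₃ * g.dist a b)))
  q2 : HasMaj (cNorm R₀ H₀ 𝔬.blk hG.lenle 2) (cNorm R₀ H₀ 𝔬.blkZ hG.lenle 2) (𝔬.Q U) (fun a b => B₃ * Real.exp (-(δ₃ * g.dist a b)))
  q1 : HasMaj (cNorm R₀ H₀ 𝔬.blk hG.lenle 1) (cNorm R₀ H₀ 𝔬.blkZ hG.lenle 1) (𝔬.Q U) (fun a b => B₃ * Real.exp (-(δ₃ * g.dist a b)))
  gXH : HasMaj (cNorm R₀ H₀ 𝔬.blkY hG.lenle 0) bXH (𝔬.G1 U ∘ₗ 𝔬.Dstar U) (fun a b => B₃ * Real.exp (-(δ₃ * g.dist a b)))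
  wGp : HasMaj bXH (cNorm R₀ H₀ 𝔬.blk hG.lenle 1) (𝔬.Dv U ∘ₗ Gp U ∘ₗ 𝔬.R U ∘ₗ 𝔬.Dvstar U)
    (fun a b => B₃ * Real.exp (-(δ₃ * g.dist a b)))

/-- the cut record from the record of `B9Thm313WholeZ` and the two new letters (so every landed supplier of a KEPT field of `Letters313Z` feeds
`Letters313Zc` by name; the located fields `gD1 ∕ rgd1` of the argument are simply not copied). [cite: Balaban1985BackgroundPropagators, Thm 3.13 p.426 (bookkeeping)] -/
theorem Letters313Zc.of_Z {𝔬 : Ops g B X Y Z W} {Gp : B.Cfg → Module.End ℝ (W → ℝ)} {R₀ : ℝ} {H₀ : Prop}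
    {bXH : BlockNorm (toB6 g R₀ H₀) (X → ℝ)} {hG : GeoOK g} {wZ : g.Site → ℝ} {hwZ : ∀ y, 0 < wZ y} {B₃ δ₃ : ℝ} {U : B.Cfg}
    (hL : Letters313Z 𝔬 R₀ H₀ hG wZ hwZ B₃ δ₃ U)
    (hXH : HasMaj (cNorm R₀ H₀ 𝔬.blkY hG.lenle 0) bXH (𝔬.G1 U ∘ₗ 𝔬.Dstar U) (fun a b => B₃ * Real.exp (-(δ₃ * g.dist a b))))
    (hW : HasMaj bXH (cNorm R₀ H₀ 𝔬.blk hG.lenle 1) (𝔬.Dv U ∘ₗ Gp U ∘ₗ 𝔬.R U ∘ₗ 𝔬.Dvstar U)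
      (fun a b => B₃ * Real.exp (-(δ₃ * g.dist a b)))) :
    Letters313Zc 𝔬 Gp R₀ H₀ hG wZ hwZ B₃ δ₃ bXH U :=
  ⟨hL.gD2, hL.gQs2, hL.gQs1, hL.rgd2, hL.c1_2, hL.c1_1, hL.q2, hL.q1, hXH, hW⟩

/-! ## §3 The (3.43) probe letters re-cut (printed species; nothing asserted) -/

/-- ★ **THE LETTERS OF THE (3.43) REDUCTIONS OF 𝔊 AT U, RE-CUT TO PRINT'S SPECIES** (`B9Thm313WholeHolderZ.Letters313HZ` minus `pXDv` — unread once
`rgd1` is gone —, plus the probe twin of `Letters313Zc.wGp`): `pYDH β`, `pXQs β` VERBATIM; `pWE β` — Φ^X_β∘(D·G′·R·D\*) : `bXH` → 𝔠_P^{(β−1)}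
(Bx β·e^{−δ₃d}; print's (3.45) species for G′ with (3.49)), the letter through which the (3.152)-cut term B of the right (3.43) member is read
(`B9Thm313WholeProbe43RHolderCut.GG_probe43R_holderCut_of_letters`' `hWE` at B_WE = Bx β).  NOTHING ASSERTED.
[cite: Balaban1985BackgroundPropagators, Thm 3.13 p.426 + (3.152)–(3.153) p.426 + (3.43)–(3.45) p.398 + (3.49) p.399; Balaban1984PropagatorsII, (2.26) p.228] -/
structure Letters313HZc (𝔬 : Ops g B X Y Z W) (𝔭 : HolderProbes g B X Y PX PY) (Gp : B.Cfg → Module.End ℝ (W → ℝ))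
    (R₀ : ℝ) (H₀ : Prop) (hG : GeoOK g) (wZ : g.Site → ℝ) (hwZ : ∀ y, 0 < wZ y)
    (bW : BlockNorm (toB6 g R₀ H₀) (W → ℝ)) (BhD Bx : ℝ → ℝ) (δ₃ : ℝ) (bXH : BlockNorm (toB6 g R₀ H₀) (X → ℝ)) (U : B.Cfg) : Prop where
  pYDH : ∀ β : ℝ, 0 ≤ β → β < 1 → HasMaj bW (cNormR R₀ H₀ 𝔭.blkPY hG.lenle (β - 1)) ((𝔭.ΦY U β ∘ₗ 𝔬.D U ∘ₗ 𝔬.G0 U) ∘ₗ 𝔬.Dv U)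
    (fun a b => BhD β * Real.exp (-(δ₃ * g.dist a b)))
  pXQs : ∀ β : ℝ, 0 ≤ β → β < 1 → HasMaj (weightNorm (BlockNorm.ofBlocks (toB6 g R₀ H₀) 𝔬.blkZ) (fun y => g.len y * wZ y) fun y => (wZlen_pos hG hwZ y).le)
    (cNormR R₀ H₀ 𝔭.blkPX hG.lenle (β - 1)) ((𝔭.ΦX U β ∘ₗ 𝔬.G0 U) ∘ₗ 𝔬.Qstar U) (fun a b => Bx β * Real.exp (-(δ₃ * g.dist a b)))
  pWE : ∀ β : ℝ, 0 ≤ β → β < 1 → HasMaj bXH (cNormR R₀ H₀ 𝔭.blkPX hG.lenle (β - 1))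
    (𝔭.ΦX U β ∘ₗ (𝔬.Dv U ∘ₗ Gp U ∘ₗ 𝔬.R U ∘ₗ 𝔬.Dvstar U)) (fun a b => Bx β * Real.exp (-(δ₃ * g.dist a b)))

omit [Fintype X] [Fintype Y] in
/-- the cut probe record from the record of `B9Thm313WholeHolderZ` and the new probe letter (the unread `pXDv` is not copied).
[cite: Balaban1985BackgroundPropagators, Thm 3.13 p.426 (bookkeeping)] -/
theorem Letters313HZc.of_HZ {𝔬 : Ops g B X Y Z W} {𝔭 : HolderProbes g B X Y PX PY} {Gp : B.Cfg → Module.End ℝ (W → ℝ)} {R₀ : ℝ} {H₀ : Prop}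
    {bXH : BlockNorm (toB6 g R₀ H₀) (X → ℝ)} {hG : GeoOK g} {wZ : g.Site → ℝ} {hwZ : ∀ y, 0 < wZ y} {bW : BlockNorm (toB6 g R₀ H₀) (W → ℝ)}
    {BhD Bx : ℝ → ℝ} {δ₃ : ℝ} {U : B.Cfg} (hH : Letters313HZ 𝔬 𝔭 R₀ H₀ hG wZ hwZ bW BhD Bx δ₃ U)
    (hWE : ∀ β : ℝ, 0 ≤ β → β < 1 → HasMaj bXH (cNormR R₀ H₀ 𝔭.blkPX hG.lenle (β - 1))
      (𝔭.ΦX U β ∘ₗ (𝔬.Dv U ∘ₗ Gp U ∘ₗ 𝔬.R U ∘ₗ 𝔬.Dvstar U)) (fun a b => Bx β * Real.exp (-(δ₃ * g.dist a b)))) :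
    Letters313HZc 𝔬 𝔭 Gp R₀ H₀ hG wZ hwZ bW BhD Bx δ₃ bXH U :=
  ⟨hH.pYDH, hH.pXQs, hWE⟩

end Letters

/-! ## §4 The block-L² pair letters re-cut (printed species; nothing asserted) -/

section L2

variable {g : B9.Geometry} {B : B9.Backgrounds} {X Y Z W P : Type} [Fintype X] [Fintype Y] [Fintype Z] [Fintype W] [Fintype g.Site]
variable {R₀ : ℝ} {H₀ : Prop}

/-- ★ **THE BLOCK-L² LETTERS OF THEOREM 3.13's REDUCTION AT U, PAIR FORM, RE-CUT TO PRINT'S SPECIES** (`B9Thm313WholeL2GPZ.Letters313L2PZ` minus the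
third-order letters `ddGDv ∕ rgdDds`, plus the two ORDER-ZERO words of the re-associated middle term of (3.153)): `gDv dGDv gQs ddGQs dGQs rgdI rgdDs c1 q`
VERBATIM (coarse side re-weighted by the free `vZ`); `vDRDG` — ‖1_{Δ(y)}D R D\*G₁μ‖₂ ≦ B₄·(L^{j′}η∕Lʲη)·e^{−δd(y,y′)}‖μ‖₂ (supp μ ⊂ Δ(y′)); `vGDRD` —
‖1_{Δ(y)}G₁D R D\*f‖₂ ≦ B₄·(Lʲη∕L^{j′}η)·e^{−δd(y,y′)}‖f‖₂ (print's (3.46)₃ species for G′ through (3.152), with (3.49) for R = ϱ(I − P); one word is the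
transpose of the other).  They are `B9Thm313WholeL2DerivCut`'s `hV ∕ hV'`.  NOTHING ASSERTED.
[cite: Balaban1985BackgroundPropagators, Thm 3.13 p.426 + (3.152)–(3.153) p.426 + (3.132) p.422 + (3.126) p.420 + (3.46) p.398 + (3.39) p.397 + (3.49) p.399 + p.398 (remark after (3.47)); Balaban1984PropagatorsII, (2.26) p.228] -/
structure Letters313L2Pc (𝔬 : Ops g B X Y Z W) (Dd Dds : B.Cfg → P → Module.End ℝ (X → ℝ)) (R₀ : ℝ) (H₀ : Prop) (B₄ δ : ℝ)
    (vZ : g.Site → ℝ) (hvZ : ∀ y, 0 < vZ y) (U : B.Cfg) : Prop where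
  gDv : BlockBd (g := toB6 g R₀ H₀) 𝔬.blkW 𝔬.blk (𝔬.G0 U ∘ₗ 𝔬.Dv U)
    (fun (y y' : g.Site) => B₄ * g.len y * Real.exp (-(δ * g.dist y y')))
  dGDv : BlockBd (g := toB6 g R₀ H₀) 𝔬.blkW 𝔬.blkY (𝔬.D U ∘ₗ 𝔬.G0 U ∘ₗ 𝔬.Dv U)
    (fun (y y' : g.Site) => B₄ * Real.exp (-(δ * g.dist y y')))
  gQs : BlockBd (g := toB6 g R₀ H₀) 𝔬.blkZ 𝔬.blk (𝔬.G0 U ∘ₗ 𝔬.Qstar U)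
    (fun (y y' : g.Site) => B₄ * g.len y * (vZ y' * g.len y') * Real.exp (-(δ * g.dist y y')))
  ddGQs : ∀ q : P × P, BlockBd (g := toB6 g R₀ H₀) 𝔬.blkZ 𝔬.blk ((Dd U q.1 ∘ₗ Dd U q.2) ∘ₗ 𝔬.G0 U ∘ₗ 𝔬.Qstar U)
    (fun (y y' : g.Site) => B₄ * ((g.len y)⁻¹ * (vZ y' * g.len y')) * Real.exp (-(δ * g.dist y y')))
  dGQs : BlockBd (g := toB6 g R₀ H₀) 𝔬.blkZ 𝔬.blkY (𝔬.D U ∘ₗ 𝔬.G0 U ∘ₗ 𝔬.Qstar U)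
    (fun (y y' : g.Site) => B₄ * (vZ y' * g.len y') * Real.exp (-(δ * g.dist y y')))
  rgdI : BlockBd (g := toB6 g R₀ H₀) 𝔬.blk 𝔬.blkW (𝔬.R U ∘ₗ 𝔬.Dvstar U ∘ₗ 𝔬.G1 U ∘ₗ LinearMap.id)
    (fun (y y' : g.Site) => B₄ * g.len y' * Real.exp (-(δ * g.dist y y')))
  rgdDs : BlockBd (g := toB6 g R₀ H₀) 𝔬.blkY 𝔬.blkW (𝔬.R U ∘ₗ 𝔬.Dvstar U ∘ₗ 𝔬.G1 U ∘ₗ 𝔬.Dstar U)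
    (fun (y y' : g.Site) => B₄ * Real.exp (-(δ * g.dist y y')))
  c1 : BlockBd (g := toB6 g R₀ H₀) 𝔬.blkZ 𝔬.blkZ (𝔬.C1 U)
    (fun (y y' : g.Site) => B₄ * (vZ y * g.len y)⁻¹ * (vZ y' * g.len y')⁻¹ * Real.exp (-(δ * g.dist y y')))
  q : BlockBd (g := toB6 g R₀ H₀) 𝔬.blk 𝔬.blkZ (𝔬.Q U)
    (fun (y y' : g.Site) => B₄ * (vZ y * g.len y * (g.len y')⁻¹) * Real.exp (-(δ * g.dist y y')))
  vDRDG : BlockBd (g := toB6 g R₀ H₀) 𝔬.blk 𝔬.blk (𝔬.Dv U ∘ₗ 𝔬.R U ∘ₗ 𝔬.Dvstar U ∘ₗ 𝔬.G1 U)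
    (fun (y y' : g.Site) => B₄ * ((g.len y)⁻¹ * g.len y') * Real.exp (-(δ * g.dist y y')))
  vGDRD : BlockBd (g := toB6 g R₀ H₀) 𝔬.blk 𝔬.blk (𝔬.G1 U ∘ₗ 𝔬.Dv U ∘ₗ 𝔬.R U ∘ₗ 𝔬.Dvstar U)
    (fun (y y' : g.Site) => B₄ * (g.len y * (g.len y')⁻¹) * Real.exp (-(δ * g.dist y y')))

/-- the Laplacian-free cut letters as a `B9Thm313WholeL2GZ.Letters313L2Z` record at the ZERO Laplacian letter (its three Laplacian fields hold trivially),
for the sibling lemma `B9Thm313WholeL2GZ.GG_l2bd_entry4Z` that reads only those — the twin of `Letters313L2PZ.toLap`.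
[cite: Balaban1985BackgroundPropagators, (3.46) p.398 (bookkeeping)] -/
theorem Letters313L2Pc.toLap {𝔬 : Ops g B X Y Z W} {Dd Dds : B.Cfg → P → Module.End ℝ (X → ℝ)} {B₄ δ : ℝ} {U : B.Cfg}
    (hB₄ : 0 ≤ B₄) (hlen : ∀ y : g.Site, 0 ≤ g.len y) {vZ : g.Site → ℝ} {hvZ : ∀ y, 0 < vZ y}
    (h : Letters313L2Pc 𝔬 Dd Dds R₀ H₀ B₄ δ vZ hvZ U) :
    Letters313L2Z 𝔬 (fun _ => (0 : Module.End ℝ (X → ℝ))) R₀ H₀ B₄ δ vZ hvZ U := by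
  have hz : ∀ {V V' : Type} [Fintype V] [Fintype V'] (bv : V → g.Site) (bv' : V' → g.Site) (K : g.Site → g.Site → ℝ),
      (∀ a b, 0 ≤ K a b) → BlockBd (g := toB6 g R₀ H₀) bv bv' (0 : (V → ℝ) →ₗ[ℝ] (V' → ℝ)) K := by
    intro V V' _ _ bv bv' K hK y' μ _ y
    rw [LinearMap.zero_apply, bl2_zero]
    exact mul_nonneg (hK y y') (bl2_nonneg _ _ _)
  have hli : ∀ y : g.Site, 0 ≤ (g.len y)⁻¹ := fun y => inv_nonneg.mpr (hlen y)
  refine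
    { gDv := h.gDv
      dGDv := h.dGDv
      gQs := h.gQs
      dGQs := h.dGQs
      rgdI := h.rgdI
      rgdDs := h.rgdDs
      c1 := h.c1
      q := h.q
      lapGDv := ?_
      lapGQs := ?_
      rgdLap := ?_ }
  · rw [LinearMap.zero_comp]
    exact hz _ _ _ fun a b => mul_nonneg (mul_nonneg hB₄ (hli a)) (Real.exp_nonneg _)
  · rw [LinearMap.zero_comp]
    exact hz _ _ _ fun a b => mul_nonneg (mul_nonneg hB₄ (mul_nonneg (hli a) (mul_nonneg (hvZ b).le (hlen b)))) (Real.exp_nonneg _)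
  · rw [LinearMap.comp_zero, LinearMap.comp_zero, LinearMap.comp_zero]
    exact hz _ _ _ fun a b => mul_nonneg (mul_nonneg hB₄ (hli b)) (Real.exp_nonneg _)

/-- the cut pair letters at a slower rate (e^{−δd} ≦ e^{−δ′d} for δ′ ≦ δ, d ≧ 0) — the twin of `letters313L2PZ_mono`.
[cite: Balaban1985BackgroundPropagators, (3.46) p.398 (bookkeeping)] -/
theorem letters313L2Pc_mono {𝔬 : Ops g B X Y Z W} {Dd Dds : B.Cfg → P → Module.End ℝ (X → ℝ)} {B₄ δ δ' : ℝ} {U : B.Cfg}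
    (hG : GeoOK g) (hB₄ : 0 ≤ B₄) (hδ : δ' ≤ δ) {vZ : g.Site → ℝ} {hvZ : ∀ y, 0 < vZ y} (h : Letters313L2Pc 𝔬 Dd Dds R₀ H₀ B₄ δ vZ hvZ U) :
    Letters313L2Pc 𝔬 Dd Dds R₀ H₀ B₄ δ' vZ hvZ U := by
  have hexp : ∀ y y' : g.Site, Real.exp (-(δ * g.dist y y')) ≤ Real.exp (-(δ' * g.dist y y')) := fun y y' =>
    Real.exp_le_exp.mpr (neg_le_neg (mul_le_mul_of_nonneg_right hδ (hG.dnn y y')))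
  have hl : ∀ y : g.Site, 0 ≤ g.len y := hG.lenle
  have hli : ∀ y : g.Site, 0 ≤ (g.len y)⁻¹ := fun y => inv_nonneg.mpr (hl y)
  have hv : ∀ y : g.Site, 0 ≤ vZ y * g.len y := fun y => (mul_pos (hvZ y) (hG.lenpos y)).le
  have hvi : ∀ y : g.Site, 0 ≤ (vZ y * g.len y)⁻¹ := fun y => inv_nonneg.mpr (hv y)
  exact
    { gDv := h.gDv.mono fun y y' => mul_le_mul_of_nonneg_left (hexp y y') (mul_nonneg hB₄ (hl y))
      dGDv := h.dGDv.mono fun y y' => mul_le_mul_of_nonneg_left (hexp y y') hB₄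
      gQs := h.gQs.mono fun y y' => mul_le_mul_of_nonneg_left (hexp y y') (mul_nonneg (mul_nonneg hB₄ (hl y)) (hv y'))
      ddGQs := fun q => (h.ddGQs q).mono fun y y' => mul_le_mul_of_nonneg_left (hexp y y') (mul_nonneg hB₄ (mul_nonneg (hli y) (hv y')))
      dGQs := h.dGQs.mono fun y y' => mul_le_mul_of_nonneg_left (hexp y y') (mul_nonneg hB₄ (hv y'))
      rgdI := h.rgdI.mono fun y y' => mul_le_mul_of_nonneg_left (hexp y y') (mul_nonneg hB₄ (hl y'))
      rgdDs := h.rgdDs.mono fun y y' => mul_le_mul_of_nonneg_left (hexp y y') hB₄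
      c1 := h.c1.mono fun y y' => mul_le_mul_of_nonneg_left (hexp y y') (mul_nonneg (mul_nonneg hB₄ (hvi y)) (hvi y'))
      q := h.q.mono fun y y' => mul_le_mul_of_nonneg_left (hexp y y') (mul_nonneg hB₄ (mul_nonneg (hv y) (hli y')))
      vDRDG := h.vDRDG.mono fun y y' => mul_le_mul_of_nonneg_left (hexp y y') (mul_nonneg hB₄ (mul_nonneg (hli y) (hl y')))
      vGDRD := h.vGDRD.mono fun y y' => mul_le_mul_of_nonneg_left (hexp y y') (mul_nonneg hB₄ (mul_nonneg (hl y) (hli y'))) }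

/-- the cut pair record from the record of `B9Thm313WholeL2GPZ` and the two order-zero words (the located `ddGDv ∕ rgdDds` of the argument are not copied).
[cite: Balaban1985BackgroundPropagators, (3.46) p.398 (bookkeeping)] -/
theorem Letters313L2Pc.of_L2PZ {𝔬 : Ops g B X Y Z W} {Dd Dds : B.Cfg → P → Module.End ℝ (X → ℝ)} {B₄ δ : ℝ} {U : B.Cfg}
    {vZ : g.Site → ℝ} {hvZ : ∀ y, 0 < vZ y} (h : Letters313L2PZ 𝔬 Dd Dds R₀ H₀ B₄ δ vZ hvZ U)
    (hV : BlockBd (g := toB6 g R₀ H₀) 𝔬.blk 𝔬.blk (𝔬.Dv U ∘ₗ 𝔬.R U ∘ₗ 𝔬.Dvstar U ∘ₗ 𝔬.G1 U)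
      (fun (y y' : g.Site) => B₄ * ((g.len y)⁻¹ * g.len y') * Real.exp (-(δ * g.dist y y'))))
    (hV' : BlockBd (g := toB6 g R₀ H₀) 𝔬.blk 𝔬.blk (𝔬.G1 U ∘ₗ 𝔬.Dv U ∘ₗ 𝔬.R U ∘ₗ 𝔬.Dvstar U)
      (fun (y y' : g.Site) => B₄ * (g.len y * (g.len y')⁻¹) * Real.exp (-(δ * g.dist y y')))) :
    Letters313L2Pc 𝔬 Dd Dds R₀ H₀ B₄ δ vZ hvZ U :=
  ⟨h.gDv, h.dGDv, h.gQs, h.ddGQs, h.dGQs, h.rgdI, h.rgdDs, h.c1, h.q, hV, hV'⟩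

end L2

end

end Literature.MathematicalPhysics.QuantumFieldTheory.Balaban1983to89.B9Thm313WholeLettersCut
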